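import Summits.QuantumFields.YangMills.Theorems.BalabanUVNodesSpineRates
import Summits.QuantumFields.YangMills.Theorems.BalabanUVNodesN27AtRecord
import Summits.QuantumFields.YangMills.Theorems.BalabanUVNodesClustersLeaf

/-!
# BalabanUVNodes ∕ N27 = binder B5 AT THE RECORD, XIV — the TOP JOINS with cluster K4 «SpineRates» BY NAME (`RateInputs RRec`, module 2
# `BalabanUVNodesSpineRates`) and K5 in the rev-1 shape (N27x · N20 · N21 · N19′ = the ∃δ-edge; U4′ RETIRED): `Spine Rec`, `UVD59 N`, and at
# `N = 2` the leaf `Summit.QuantumFields.YangMills.Theses.BalabanLadder.UV` — every K1–K5 stub in the term, no budget clause, no `S.δ`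
# (cell `pub-ymgap`, HUMAN RULING D-0062 Track A, seat `pub-ymgap-dag-n27-a` g4; `--supports stmt-QuantumFields-19182`, count-neutral)

WHY.  Module 2 of the route package instantiates K4's conclusion as `RateInputs RRec` («some rate carriers of record carry the six in-edges of N19:
N14 · N15 · N16 · N17 · N18 · N22», `RatesAt D R`) and proves `SpineRates_of` (∃-packaging) ∕ `uvD59_of_K4K5stubs` with K5 read through
`SpineMatching_of`, i.e. WITH the stub `S_U4 SRec` (budget clause + `Summable S.δ`).  File XII retired U4′ for B5 (`spineMatching_of_coreEdge`,
`spine_of_coreEdge`: N19 as the ∃δ-edge, budget clause derived in the tail).  THIS FILE composes the two BY NAME: the top joins of the route with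
K4 at `RateInputs RRec` and K5 in the rev-1 shape — the plan's design of record [YMPLAN-G62-WORD-N19-JUNCTION] (d) typed over today's decls.

WHAT IS KERNEL-CHECKED ([bookkeeping]; 0 `def`, 0 `sorry`).
* §1 `coreEdge_of_rateEdge` — the N19′ edge at `Inputs := RateInputs RRec` from its unpacked form «`SRec … S → RRec … R → RatesAt D R → ∃ δ, Core ∧
  Summable δ`» (`rateInputs_iff`, bookkeeping).
* §2 `spine_of_rateStubs_coreEdge` — R00x · N14 · N15 · N16 · N17 · N18 · N22 (K4 stubs) · N27x · N20 · N21 · the N19′ edge ⇒ `Spine Rec`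
  (`spine_of_coreEdge ∘ SpineRates_of`); `spine_of_rateStubs_coreEdge_glueN17` (N17 GLUED from (D4) · N18 · N22, `N17_of_U3edge`).
* §3 `uvD59_of_K4K5stubs_coreEdge` — K1 «KnitIR» → K2 «FlowBounds» → K3 «RenormalisationBeta» → the K4 stubs → K5 (rev-1 shape) ⇒ `UVD59 N`
  (`uvD59_of_clusters ∘ SpineRates_of ∘ spineMatching_of_coreEdge`); `ladderUV_of_K4K5stubs_coreEdge` — at `N = 2` the leaf
  `…Theses.BalabanLadder.UV` BY NAME (`uvD59_two_iff`).

HONEST FRAMING.  Bookkeeping over PARAMETERS `Rec`, `SRec`, `RRec`: no record predicate, no carrier, no estimate of Bałaban's is instantiated or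
asserted; the K1–K5 stubs are HYPOTHESES; NE1′ ∕ NE2 ∕ NE3 ∕ NE4 ∕ NE5 ∕ NE9 ∕ NE7 ∕ NE7b ∕ NE7c are hypothesis shapes, none proved; NO node is
discharged; typed 28∕28, the discharged count is not touched; one finite four-torus programme — NOT ℝ⁴, NOT infinite volume, NOT OS, NOT a mass
gap, NOT Clay.  Restate-immune (neither the Theses file nor g0's module imported).  No decl below carries a cite tag.
-/

namespace Summit.QuantumFields.YangMills.Theorems.BalabanUVNodesN27SpineRecord

open Literature.MathematicalPhysics.QuantumFieldTheory.Balaban1983to89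
open Literature.MathematicalPhysics.QuantumFieldTheory.Balaban1983to89.T4Continuum
open Summit.QuantumFields.BalabanUV.T4Continuum.Spine
open YMDAG.UVSplit

section RateRecord

variable {N : ℕ} [NeZero N] (Rec : RecordPred N) (SRec : SpineRecordPred N) (RRec : RateRecordPred N)

/-! ## §1 The N19′ edge at `Inputs := RateInputs RRec`, unpacked -/

/-- The ∃δ-edge of N19 at K4's instantiated conclusion `RateInputs RRec`, from its unpacked reading «at the spine carriers of record `S` and the rate
carriers of record `R` carrying the six in-edges (`RatesAt D R`), SOME summable remainder carries `Spine.NE7.Core` on the shell-free cores».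
[bookkeeping] -/
theorem coreEdge_of_rateEdge
    (h : ∀ (F : T4Family) (D : Datum F N) (g₀ : ℕ → ℝ) (os : List (ULoop F)) (S : SpineCarriers) (R : RateCarriers N),
      SRec F D g₀ os S → RRec F D g₀ os R → RatesAt D R → letI := S.dec
        ∃ δ : ℕ → ℝ, NE7.Core S.l₀ S.vol S.T S.Bad (fun K t τ => S.A K t τ - S.shA K t τ) (fun K t τ => S.B K t τ - S.shB K t τ) δ ∧
          Summable δ)
    (F : T4Family) (D : Datum F N) (g₀ : ℕ → ℝ) (os : List (ULoop F)) (S : SpineCarriers)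
    (hS : SRec F D g₀ os S) (hin : RateInputs RRec F D g₀ os) : letI := S.dec
      ∃ δ : ℕ → ℝ, NE7.Core S.l₀ S.vol S.T S.Bad (fun K t τ => S.A K t τ - S.shA K t τ) (fun K t τ => S.B K t τ - S.shB K t τ) δ ∧
        Summable δ := by
  obtain ⟨R, hR, hrates⟩ := hin
  exact h F D g₀ os S R hS hR hrates

/-! ## §2 B5 at the record from the K4 stubs and K5 in the rev-1 shape -/

/-- **B5 AT THE RECORD FROM THE K4 STUBS AND THE REV-1 K5**: R00x (rate carriers of record exist under the pins) · N14 · N15 · N16 · N17 · N18 · N22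
BY NAME at them · N27x · N20 · N21 · the N19′ edge (unpacked at the two carrier records) ⇒ `Spine Rec` — `spine_of_coreEdge` at
`Inputs := RateInputs RRec` with K4's hook from module 2's `SpineRates_of`.  No `S_U4`, no `S.δ`. [bookkeeping] -/
theorem spine_of_rateStubs_coreEdge (hx : S_R00x Rec RRec) (h14 : S_N14 RRec) (h15 : S_N15 RRec) (h16 : S_N16 RRec) (h17 : S_N17 RRec)
    (h18 : S_N18 RRec) (h22 : S_N22 RRec) (hx' : S_N27x Rec SRec) (h20 : S_N20 SRec) (h21 : S_N21 SRec)
    (h19 : ∀ (F : T4Family) (D : Datum F N) (g₀ : ℕ → ℝ) (os : List (ULoop F)) (S : SpineCarriers) (R : RateCarriers N),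
      SRec F D g₀ os S → RRec F D g₀ os R → RatesAt D R → letI := S.dec
        ∃ δ : ℕ → ℝ, NE7.Core S.l₀ S.vol S.T S.Bad (fun K t τ => S.A K t τ - S.shA K t τ) (fun K t τ => S.B K t τ - S.shB K t τ) δ ∧
          Summable δ) :
    Spine Rec :=
  spine_of_coreEdge Rec SRec (RateInputs RRec) hx' h20 h21 (coreEdge_of_rateEdge SRec RRec h19)
    (SpineRates_of Rec RRec hx h14 h15 h16 h17 h18 h22)

/-- The same with N17 GLUED from (D4) · N18 · N22 (`N17_of_U3edge`). [bookkeeping] -/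
theorem spine_of_rateStubs_coreEdge_glueN17 (hx : S_R00x Rec RRec) (h14 : S_N14 RRec) (h15 : S_N15 RRec) (h16 : S_N16 RRec)
    (h18 : S_N18 RRec) (h22 : S_N22 RRec) (hD4 : S_D4 RRec) (hx' : S_N27x Rec SRec) (h20 : S_N20 SRec) (h21 : S_N21 SRec)
    (h19 : ∀ (F : T4Family) (D : Datum F N) (g₀ : ℕ → ℝ) (os : List (ULoop F)) (S : SpineCarriers) (R : RateCarriers N),
      SRec F D g₀ os S → RRec F D g₀ os R → RatesAt D R → letI := S.dec
        ∃ δ : ℕ → ℝ, NE7.Core S.l₀ S.vol S.T S.Bad (fun K t τ => S.A K t τ - S.shA K t τ) (fun K t τ => S.B K t τ - S.shB K t τ) δ ∧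
          Summable δ) :
    Spine Rec :=
  spine_of_rateStubs_coreEdge Rec SRec RRec hx h14 h15 h16 (N17_of_U3edge RRec hD4 h18 h22) h18 h22 hx' h20 h21 h19

/-! ## §3 The rung and the leaf -/

/-- **THE TOP JOIN AT STUB LEVEL, K5 IN THE REV-1 SHAPE**: K1 «KnitIR» → K2 «FlowBounds» → K3 «RenormalisationBeta» → the seven K4 stubs (∃-packaging,
N17 a stub) → N27x · N20 · N21 · the N19′ edge ⇒ `UVD59 N` — module 2's `uvD59_of_K4K5stubs` with `S_N19 SRec (RateInputs RRec)` + `S_U4 SRec`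
REPLACED by the ∃δ-edge (`uvD59_of_clusters ∘ SpineRates_of ∘ spineMatching_of_coreEdge`).  Every K1–K5 stub is in the term. [bookkeeping] -/
theorem uvD59_of_K4K5stubs_coreEdge (h1 : KnitIR Rec) (h2 : FlowBounds Rec) (h3 : RenormalisationBeta Rec)
    (hx : S_R00x Rec RRec) (h14 : S_N14 RRec) (h15 : S_N15 RRec) (h16 : S_N16 RRec) (h17 : S_N17 RRec) (h18 : S_N18 RRec)
    (h22 : S_N22 RRec) (hx' : S_N27x Rec SRec) (h20 : S_N20 SRec) (h21 : S_N21 SRec)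
    (h19 : ∀ (F : T4Family) (D : Datum F N) (g₀ : ℕ → ℝ) (os : List (ULoop F)) (S : SpineCarriers) (R : RateCarriers N),
      SRec F D g₀ os S → RRec F D g₀ os R → RatesAt D R → letI := S.dec
        ∃ δ : ℕ → ℝ, NE7.Core S.l₀ S.vol S.T S.Bad (fun K t τ => S.A K t τ - S.shA K t τ) (fun K t τ => S.B K t τ - S.shB K t τ) δ ∧
          Summable δ) :
    UVD59 N :=
  uvD59_of_clusters Rec (RateInputs RRec) h1 h2 h3 (SpineRates_of Rec RRec hx h14 h15 h16 h17 h18 h22)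
    (spineMatching_of_coreEdge Rec SRec (RateInputs RRec) hx' h20 h21 (coreEdge_of_rateEdge SRec RRec h19))

end RateRecord

section LadderGlue

variable (Rec : RecordPred 2) (SRec : SpineRecordPred 2) (RRec : RateRecordPred 2)

/-- **AT THE LEAF OF RECORD** `Summit.QuantumFields.YangMills.Theses.BalabanLadder.UV` (= `UVD59 2`, `uvD59_two_iff`): the stub-level top join with K5
in the rev-1 shape, at SU(2). [bookkeeping] -/
theorem ladderUV_of_K4K5stubs_coreEdge (h1 : KnitIR Rec) (h2 : FlowBounds Rec) (h3 : RenormalisationBeta Rec)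
    (hx : S_R00x Rec RRec) (h14 : S_N14 RRec) (h15 : S_N15 RRec) (h16 : S_N16 RRec) (h17 : S_N17 RRec) (h18 : S_N18 RRec)
    (h22 : S_N22 RRec) (hx' : S_N27x Rec SRec) (h20 : S_N20 SRec) (h21 : S_N21 SRec)
    (h19 : ∀ (F : T4Family) (D : Datum F 2) (g₀ : ℕ → ℝ) (os : List (ULoop F)) (S : SpineCarriers) (R : RateCarriers 2),
      SRec F D g₀ os S → RRec F D g₀ os R → RatesAt D R → letI := S.dec
        ∃ δ : ℕ → ℝ, NE7.Core S.l₀ S.vol S.T S.Bad (fun K t τ => S.A K t τ - S.shA K t τ) (fun K t τ => S.B K t τ - S.shB K t τ) δ ∧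
          Summable δ) :
    Summit.QuantumFields.YangMills.Theses.BalabanLadder.UV :=
  uvD59_two_iff.mp (uvD59_of_K4K5stubs_coreEdge Rec SRec RRec h1 h2 h3 hx h14 h15 h16 h17 h18 h22 hx' h20 h21 h19)

end LadderGlue

end Summit.QuantumFields.YangMills.Theorems.BalabanUVNodesN27SpineRecord
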